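import Summits.QuantumAdvantage.QuantumAdvantage.Theorems.LinnikCubicClassGroupsDegreeOnePrimesEscapeDivisionPNTPiLemmas
import Literature.NumberTheory.LFunctions.UniformClassGroupPNTInputs
import HarnessLib

/-!
# Partial summation over the prime ideals of a number field, for the `π`-form of the relative Chebotarev theorem

Topic `Summits/QuantumAdvantage/QuantumAdvantage/Theorems`, cell B2b-1 (linnik-cubic), PART A (gen 16); helper
toward the crux `DegreeOnePrimesEscape` (stmt-QuantumAdvantage-11543) — the Abel-summation package of
`…DivisionPNTPiLemmas.lean` (gen 10, subsets of the rational primes) for subsets of the prime ideals of a number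
field `F`, as needed by `frobeniusClass_PNT_pi_relative` (`…ConjClassPNTRelativePi.lean`).  HONEST FRAMING: the
value of this file is a THEOREM (kernel-checked bookkeeping) — NOT summit progress.

For a predicate `P` on the ideals of `𝓞_F` write `T_P(t) = Σ_{𝔮 prime, N𝔮 ≤ t, P 𝔮} log N𝔮` and
`π_P(x) = #{𝔮 prime : N𝔮 ≤ x, P 𝔮}`.
* `sum_filter_primeIdealsLE_log_mono`, `sum_filter_primeIdealsLE_log_le` — `T_P` is monotone and
  `0 ≤ T_P(t) ≤ θ_F(t) ≤ [F:ℚ](log 4 + 4) t`;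
* `intervalIntegrable_sum_filter_primeIdealsLE_log_div` — `T_P(t)/(t log² t)` is integrable on `[2, x]`;
* `card_filter_primeIdealsLE_eq_div_log_add_integral` — **Abel summation**:
  `π_P(x) = T_P(x)/log x + ∫₂ˣ T_P(t) dt/(t log² t)` for `x ≥ 2` (grouping the prime ideals by their norm and
  applying Mathlib's `sum_mul_eq_sub_integral_mul₁`).
-/

noncomputable section

open scoped NumberField
open Finset Real Ideal NumberField MeasureTheory
open Literature.NumberTheory.LFunctions Literature.NumberTheory.LFunctions.NumberField

namespace Summit.QuantumAdvantage.QuantumAdvantage.Theorems.DegreeOnePrimesEscape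

variable {F : Type} [Field F] [NumberField F] (P : Ideal (𝓞 F) → Prop) [DecidablePred P]

/-- `t ↦ Σ_{N𝔮 ≤ t, P 𝔮} log N𝔮` is monotone. -/
theorem sum_filter_primeIdealsLE_log_mono :
    Monotone fun t : ℝ => ∑ q ∈ (finite_primeIdealsLE F t).toFinset with P q, Real.log (Ideal.absNorm q : ℝ) := by
  intro s t hst
  refine Finset.sum_le_sum_of_subset_of_nonneg (Finset.filter_subset_filter P ?_)
    fun q _ _ => Real.log_natCast_nonneg _
  intro q hq
  rw [Set.Finite.mem_toFinset] at hq ⊢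
  exact ⟨hq.1, hq.2.1, hq.2.2.trans hst⟩

/-- `0 ≤ Σ_{N𝔮 ≤ t, P 𝔮} log N𝔮 ≤ θ_F(t) ≤ [F:ℚ](log 4 + 4) t` for `t ≥ 0`. -/
theorem sum_filter_primeIdealsLE_log_le {t : ℝ} (ht : 0 ≤ t) :
    0 ≤ ∑ q ∈ (finite_primeIdealsLE F t).toFinset with P q, Real.log (Ideal.absNorm q : ℝ) ∧
      ∑ q ∈ (finite_primeIdealsLE F t).toFinset with P q, Real.log (Ideal.absNorm q : ℝ) ≤
        Module.finrank ℚ F * (Real.log 4 + 4) * t := by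
  refine ⟨Finset.sum_nonneg fun q _ => Real.log_natCast_nonneg _, ?_⟩
  calc ∑ q ∈ (finite_primeIdealsLE F t).toFinset with P q, Real.log (Ideal.absNorm q : ℝ)
      ≤ ∑ q ∈ (finite_primeIdealsLE F t).toFinset, Real.log (Ideal.absNorm q : ℝ) :=
        Finset.sum_le_sum_of_subset_of_nonneg (Finset.filter_subset _ _) fun q _ _ => Real.log_natCast_nonneg _
    _ = chebyshevThetaIdeal F t := (chebyshevThetaIdeal_eq_sum_primeIdealsLE F ht).symm
    _ ≤ Module.finrank ℚ F * (Real.log 4 + 4) * t := chebyshevThetaIdeal_le_mul F ht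

/-- `t ↦ (Σ_{N𝔮 ≤ t, P 𝔮} log N𝔮)/(t log² t)` is interval integrable on `[2, x]`. -/
theorem intervalIntegrable_sum_filter_primeIdealsLE_log_div {x : ℝ} (hx : 2 ≤ x) :
    IntervalIntegrable (fun t : ℝ =>
      (∑ q ∈ (finite_primeIdealsLE F t).toFinset with P q, Real.log (Ideal.absNorm q : ℝ)) / (t * Real.log t ^ 2))
      volume 2 x := by
  have hcont : ContinuousOn (fun t : ℝ => (t * Real.log t ^ 2)⁻¹) (Set.uIcc 2 x) := by
    refine fun t ht => ContinuousAt.continuousWithinAt ?_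
    rw [Set.uIcc_of_le hx] at ht
    have ht0 : t ≠ 0 := by linarith [ht.1]
    have : t * Real.log t ^ 2 ≠ 0 :=
      mul_ne_zero ht0 (pow_ne_zero 2 (Real.log_pos (by linarith [ht.1])).ne')
    fun_prop (disch := assumption)
  have h := ((sum_filter_primeIdealsLE_log_mono P).intervalIntegrable (μ := volume) (a := 2) (b := x)).mul_continuousOn
    hcont
  have heq : (fun t : ℝ =>
      (∑ q ∈ (finite_primeIdealsLE F t).toFinset with P q, Real.log (Ideal.absNorm q : ℝ)) / (t * Real.log t ^ 2)) =
      fun t : ℝ => (∑ q ∈ (finite_primeIdealsLE F t).toFinset with P q, Real.log (Ideal.absNorm q : ℝ)) *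
        (t * Real.log t ^ 2)⁻¹ := by
    funext t; rw [div_eq_mul_inv]
  rw [heq]; exact h

/-- **Abel summation for a predicate-restricted prime ideal count**: for `x ≥ 2`,
`#{𝔮 : N𝔮 ≤ x, P 𝔮} = (Σ_{N𝔮 ≤ x, P 𝔮} log N𝔮)/log x + ∫₂ˣ (Σ_{N𝔮 ≤ t, P 𝔮} log N𝔮) dt/(t log² t)`. -/
theorem card_filter_primeIdealsLE_eq_div_log_add_integral {x : ℝ} (hx : 2 ≤ x) :
    ((((finite_primeIdealsLE F x).toFinset.filter P).card : ℕ) : ℝ) =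
      (∑ q ∈ (finite_primeIdealsLE F x).toFinset with P q, Real.log (Ideal.absNorm q : ℝ)) / Real.log x +
        ∫ t in (2 : ℝ)..x,
          (∑ q ∈ (finite_primeIdealsLE F t).toFinset with P q, Real.log (Ideal.absNorm q : ℝ)) / (t * Real.log t ^ 2) := by
  classical
  -- the fibres of the norm map on the primes `≤ t` satisfying `P`
  have hfib : ∀ {t : ℝ} {k : ℕ}, k ≠ 0 → (k : ℝ) ≤ t →
      ((finite_primeIdealsLE F t).toFinset.filter P).filter (fun q => Ideal.absNorm q = k) =
        (idealsOfNorm F k).filter (fun I => I.IsPrime ∧ P I) := by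
    intro t k hk hkt
    ext q
    simp only [Finset.mem_filter, Set.Finite.mem_toFinset, mem_idealsOfNorm]
    constructor
    · rintro ⟨⟨⟨hqp, -, -⟩, hP⟩, hN⟩
      exact ⟨hN, hqp, hP⟩
    · rintro ⟨hN, hqp, hP⟩
      refine ⟨⟨⟨hqp, ?_, by rw [hN]; exact hkt⟩, hP⟩, hN⟩
      intro h0
      rw [h0, Ideal.absNorm_bot] at hN
      exact hk hN.symm
  have hfib0 : ∀ {t : ℝ} {k : ℕ}, (k = 0 ∨ k = 1) →
      ((finite_primeIdealsLE F t).toFinset.filter P).filter (fun q => Ideal.absNorm q = k) = ∅ := by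
    intro t k hk
    ext q
    simp only [Finset.mem_filter, Set.Finite.mem_toFinset, Finset.notMem_empty, iff_false, not_and]
    rintro ⟨⟨hqp, hq0, -⟩, -⟩ hN
    rcases hk with rfl | rfl
    · exact hq0 (Ideal.absNorm_eq_zero_iff.mp hN)
    · exact hqp.ne_top (Ideal.absNorm_eq_one_iff.mp hN)
  -- the norm-`k` layer
  set c : ℕ → ℝ := fun k => (((idealsOfNorm F k).filter (fun I => I.IsPrime ∧ P I)).card : ℝ) with hc
  set a : ℕ → ℝ := fun k => if k = 0 ∨ k = 1 then 0 else c k * Real.log k with ha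
  have ha0 : a 0 = 0 := by simp [ha]
  have ha1 : a 1 = 0 := by simp [ha]
  -- the norm map sends the primes `≤ t` into `Icc 0 ⌊t⌋`
  have hmaps : ∀ t : ℝ, ∀ q ∈ (finite_primeIdealsLE F t).toFinset.filter P, Ideal.absNorm q ∈ Icc 0 ⌊t⌋₊ := by
    intro t q hq
    rw [Finset.mem_filter, Set.Finite.mem_toFinset] at hq
    exact Finset.mem_Icc.mpr ⟨Nat.zero_le _, Nat.le_floor hq.1.2.2⟩
  -- the weighted theta as a sum over `Icc 0 ⌊t⌋`
  have hS : ∀ t : ℝ, ∑ k ∈ Icc 0 ⌊t⌋₊, a k =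
      ∑ q ∈ (finite_primeIdealsLE F t).toFinset with P q, Real.log (Ideal.absNorm q : ℝ) := by
    intro t
    rw [← Finset.sum_fiberwise_of_maps_to (hmaps t)]
    refine Finset.sum_congr rfl fun k hk => ?_
    by_cases h01 : k = 0 ∨ k = 1
    · rw [ha]; dsimp only; rw [if_pos h01, hfib0 h01, Finset.sum_empty]
    · have hk0 : k ≠ 0 := fun h => h01 (Or.inl h)
      have hkt : (k : ℝ) ≤ t := by
        have h1 := (Finset.mem_Icc.mp hk).2
        rcases le_or_gt 0 t with ht | ht
        · exact le_trans (by exact_mod_cast h1) (Nat.floor_le ht)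
        · exfalso
          rw [Nat.floor_eq_zero.mpr (by linarith)] at h1
          exact hk0 (Nat.le_zero.mp h1)
      rw [ha]; dsimp only
      rw [if_neg h01, hfib hk0 hkt, hc]; dsimp only
      have hterm : ∑ i ∈ (idealsOfNorm F k).filter (fun I => I.IsPrime ∧ P I), Real.log (Ideal.absNorm i : ℝ) =
          ∑ i ∈ (idealsOfNorm F k).filter (fun I => I.IsPrime ∧ P I), Real.log (k : ℝ) :=
        Finset.sum_congr rfl fun i hi => by rw [mem_idealsOfNorm.mp (Finset.mem_filter.mp hi).1]
      rw [hterm, Finset.sum_const, nsmul_eq_mul]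
  -- the count as `Σ (log k)⁻¹ a k`
  have hcount : ((((finite_primeIdealsLE F x).toFinset.filter P).card : ℕ) : ℝ) =
      ∑ k ∈ Icc 0 ⌊x⌋₊, (fun t : ℝ => (Real.log t)⁻¹) k * a k := by
    rw [Finset.card_eq_sum_ones, Nat.cast_sum, ← Finset.sum_fiberwise_of_maps_to (hmaps x)]
    refine Finset.sum_congr rfl fun k hk => ?_
    by_cases h01 : k = 0 ∨ k = 1
    · rw [hfib0 h01, Finset.sum_empty, ha]; dsimp only
      rw [if_pos h01, mul_zero]
    · have hk0 : k ≠ 0 := fun h => h01 (Or.inl h)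
      have hk1 : k ≠ 1 := fun h => h01 (Or.inr h)
      have hkt : (k : ℝ) ≤ x := by
        have h1 := (Finset.mem_Icc.mp hk).2
        exact le_trans (by exact_mod_cast h1) (Nat.floor_le (by linarith))
      rw [hfib hk0 hkt, ha]; dsimp only
      rw [if_neg h01, hc]; dsimp only
      have hlog : Real.log k ≠ 0 :=
        Real.log_ne_zero_of_pos_of_ne_one (by exact_mod_cast Nat.pos_of_ne_zero hk0) (by exact_mod_cast hk1)
      rw [← mul_assoc, mul_comm ((Real.log (k : ℝ))⁻¹), mul_assoc, inv_mul_cancel₀ hlog, mul_one, Finset.sum_const,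
        nsmul_eq_mul, Nat.cast_one, mul_one]
  rw [hcount, sum_mul_eq_sub_integral_mul₁ a (f := fun t : ℝ => (Real.log t)⁻¹) ha0 ha1 x ?hdiff ?hint,
    ← intervalIntegral.integral_of_le hx]
  case hdiff =>
    intro z ⟨hz1, _⟩
    have : z ≠ 0 := by linarith
    have : Real.log z ≠ 0 := by apply Real.log_ne_zero_of_pos_of_ne_one <;> linarith
    fun_prop
  case hint =>
    refine ContinuousOn.integrableOn_Icc fun z ⟨hz1, _⟩ => ContinuousWithinAt.congr ?_
      (fun _ _ => Real.deriv_inv_log_apply) Real.deriv_inv_log_apply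
    have : z ≠ 0 := by linarith
    have : Real.log z ^ 2 ≠ 0 := by
      refine pow_ne_zero 2 <| Real.log_ne_zero_of_pos_of_ne_one ?_ ?_ <;> linarith
    exact ContinuousAt.continuousWithinAt <| by fun_prop
  simp only [hS, Real.deriv_inv_log]
  have hI : ∫ t in (2 : ℝ)..x, -t⁻¹ / Real.log t ^ 2 *
      ∑ q ∈ (finite_primeIdealsLE F t).toFinset with P q, Real.log (Ideal.absNorm q : ℝ) =
      -∫ t in (2 : ℝ)..x,
        (∑ q ∈ (finite_primeIdealsLE F t).toFinset with P q, Real.log (Ideal.absNorm q : ℝ)) / (t * Real.log t ^ 2) := by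
    rw [← intervalIntegral.integral_neg]
    exact intervalIntegral.integral_congr fun t _ => by ring
  rw [hI]
  ring

end Summit.QuantumAdvantage.QuantumAdvantage.Theorems.DegreeOnePrimesEscape

end
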